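import Summits.MatrixMultiplication.MatrixMultiplication.Theorems.AbelianSTPPCensusShapeCertVPDefs

/-!
# Abelian STPP census — kernel evaluation of the vP certificate checker `ShapeCertVP` (F: orders 280–299)

Cell mm-stpp, route `AbelianSTPPCensusVP`, crux `ShapeExclusionVP337` (stmt-MatrixMultiplication-19191); support file
(no definitions).  `ShapeCertVP.checkV M = true` by `decide +kernel` (no `native_decide`, standard axioms), ONE theorem
per order so that every kernel evaluation starts with empty caches (measured in the seat folder: ≈ 4–8 s per order below
300, ≤ 35 s at the orders 300–337 — candidate-list construction plus the `feasP` packings of the visited nodes);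
`Elab.async false` keeps the evaluations of this file sequential (one kernel computation in memory at a time; tree
precedent `NeelSignC23EK0Cert4`).  The range lemma `checkV_280_299` at the end collects the file; the ten ranges are
assembled on `128 ≤ M ≤ 337` in `AbelianSTPPCensusVPShapeExclusionVP337.lean`, where `ShapeCertVP.checkV_sound`
(`…ShapeCertVPSearch`) and the bridge `ShapeCertVP.shapeExclusionVP_of_checkV` (`…ShapeCertVPFinal`) turn them into
the crux.
-/

set_option linter.dupNamespace false -- `MatrixMultiplication.MatrixMultiplication` (summit = problem, D-0017)
set_option autoImplicit false
set_option Elab.async false -- sequential kernel evaluations (memory high-water of one order at a time)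

namespace Summit.MatrixMultiplication.MatrixMultiplication.Theorems.ShapeCertVP

set_option maxHeartbeats 0 in
/-- certificate check at order `280` (kernel evaluation) -/
theorem checkV_280 : checkV 280 = true := by
  decide +kernel

set_option maxHeartbeats 0 in
/-- certificate check at order `281` (kernel evaluation) -/
theorem checkV_281 : checkV 281 = true := by
  decide +kernel

set_option maxHeartbeats 0 in
/-- certificate check at order `282` (kernel evaluation) -/
theorem checkV_282 : checkV 282 = true := by
  decide +kernel

set_option maxHeartbeats 0 in
/-- certificate check at order `283` (kernel evaluation) -/
theorem checkV_283 : checkV 283 = true := by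
  decide +kernel

set_option maxHeartbeats 0 in
/-- certificate check at order `284` (kernel evaluation) -/
theorem checkV_284 : checkV 284 = true := by
  decide +kernel

set_option maxHeartbeats 0 in
/-- certificate check at order `285` (kernel evaluation) -/
theorem checkV_285 : checkV 285 = true := by
  decide +kernel

set_option maxHeartbeats 0 in
/-- certificate check at order `286` (kernel evaluation) -/
theorem checkV_286 : checkV 286 = true := by
  decide +kernel

set_option maxHeartbeats 0 in
/-- certificate check at order `287` (kernel evaluation) -/
theorem checkV_287 : checkV 287 = true := by
  decide +kernel

set_option maxHeartbeats 0 in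
/-- certificate check at order `288` (kernel evaluation) -/
theorem checkV_288 : checkV 288 = true := by
  decide +kernel

set_option maxHeartbeats 0 in
/-- certificate check at order `289` (kernel evaluation) -/
theorem checkV_289 : checkV 289 = true := by
  decide +kernel

set_option maxHeartbeats 0 in
/-- certificate check at order `290` (kernel evaluation) -/
theorem checkV_290 : checkV 290 = true := by
  decide +kernel

set_option maxHeartbeats 0 in
/-- certificate check at order `291` (kernel evaluation) -/
theorem checkV_291 : checkV 291 = true := by
  decide +kernel

set_option maxHeartbeats 0 in
/-- certificate check at order `292` (kernel evaluation) -/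
theorem checkV_292 : checkV 292 = true := by
  decide +kernel

set_option maxHeartbeats 0 in
/-- certificate check at order `293` (kernel evaluation) -/
theorem checkV_293 : checkV 293 = true := by
  decide +kernel

set_option maxHeartbeats 0 in
/-- certificate check at order `294` (kernel evaluation) -/
theorem checkV_294 : checkV 294 = true := by
  decide +kernel

set_option maxHeartbeats 0 in
/-- certificate check at order `295` (kernel evaluation) -/
theorem checkV_295 : checkV 295 = true := by
  decide +kernel

set_option maxHeartbeats 0 in
/-- certificate check at order `296` (kernel evaluation) -/
theorem checkV_296 : checkV 296 = true := by
  decide +kernel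

set_option maxHeartbeats 0 in
/-- certificate check at order `297` (kernel evaluation) -/
theorem checkV_297 : checkV 297 = true := by
  decide +kernel

set_option maxHeartbeats 0 in
/-- certificate check at order `298` (kernel evaluation) -/
theorem checkV_298 : checkV 298 = true := by
  decide +kernel

set_option maxHeartbeats 0 in
/-- certificate check at order `299` (kernel evaluation) -/
theorem checkV_299 : checkV 299 = true := by
  decide +kernel

/-- **The vP certificate holds at every order `280 ≤ M ≤ 299`** (collects the evaluations of this file). -/
theorem checkV_280_299 (M : ℕ) (h₁ : 280 ≤ M) (h₂ : M ≤ 299) : checkV M = true := by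
  interval_cases M
  · exact checkV_280
  · exact checkV_281
  · exact checkV_282
  · exact checkV_283
  · exact checkV_284
  · exact checkV_285
  · exact checkV_286
  · exact checkV_287
  · exact checkV_288
  · exact checkV_289
  · exact checkV_290
  · exact checkV_291
  · exact checkV_292
  · exact checkV_293
  · exact checkV_294
  · exact checkV_295
  · exact checkV_296
  · exact checkV_297
  · exact checkV_298
  · exact checkV_299

end Summit.MatrixMultiplication.MatrixMultiplication.Theorems.ShapeCertVP
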